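import Mathlib
import Summits.QuantumFields.YangMills.Theorems.ParabolicTrajectoryContinuumLimitOnTrajectoryUclSums
import Summits.QuantumFields.YangMills.Theorems.ConvexGribovBodyContinuumLegGivenGapStubObsGeometry
import Summits.QuantumFields.YangMills.Theorems.ConvexGribovBodyContinuumLegGivenGapCsclTorusForms
import Literature.MathematicalPhysics.QuantumFieldTheory.SpeciesTimeReflection
import Literature.MathematicalPhysics.QuantumLattice.LatticeGaugeDLRCovarianceSplit
import HarnessLib

/-!
# `ContinuumLegGivenGap` (stmt-QuantumFields-15828), line `Sketch`, reshape 18: `stub_csclLattice` — Schwartz lattice-weight tails; YMSpecies packaging of lattice representatives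

Support file for the crux item stmt-QuantumFields-15828 (registered glue stub `stub_csclLattice` of line `Sketch`, reshape 18).

The lattice representative of an `n`-point test function `F` at spacing `a` on the torus of half-side `L` is
`𝔛(V) = ∑_{x ∈ (box 4 L)ⁿ} F(a x⃗) ∏ᵢ (P(τ_{xᵢ}V) − mc)`, `P = r.curvature.F` the Wilson action density,
`τ_x = configShift (−x)`. This file proves the two elementary facts the assembly `stub_csclOfLock` consumes:

* (1) `csclLattice_tail` — **far box tails of the Schwartz lattice weights**: for `0 < a` and `ε > 0` there is a box
  radius `R` such that `∑_{x ∈ T} (1 + ‖a x⃗‖)^{-8p} ≤ ε` for every finite set `T` of `p`-tuples each having a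
  coordinate site outside `box 4 R`. Proof: the weights are summable over `(ℤ⁴)ᵖ` (`csclLattice_summable`: the partial
  sums over powers of boxes are `≤ a^{-4p} (2(a+1))^{4p}` by the tree's mesh-uniform Riemann bound
  `sum_piFinset_box_japaneseBracket_le`, and every finite set of tuples sits in a power of a box), then the Cauchy
  criterion `summable_iff_vanishing`.
* (2) **packaging of `𝔛`**: it is measurable (`csclLattice_rep_measurable`), bounded (`csclLattice_rep_bounded`), gauge
  invariant (`csclLattice_rep_gaugeInvariant`) and a cylinder on the translated curvature supports of the tuples of
  non-zero weight (`csclLattice_rep_isCylinder`); when `tsupport F ⊆ {a ≤ xᵢ⁰ ≤ T}` these tuples have lattice times in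
  `[1, ⌈T/a⌉₊]` (`csclLattice_time_of_ne_zero`), so the edge set has times in `[1, ⌈T/a⌉₊ + 1]`
  (`csclLattice_window_mem`, `csclLattice_window_time`; curvature support coordinates are `0` or `1`). Hence `Re 𝔛`,
  `Im 𝔛` are local gauge-invariant observables (`YMSpecies`, `csclLattice_rep_species`) and so are their site time
  reflections `V ↦ 𝔛(Θ₀V)` (`LocalGaugeObservable.timeReflect` of the tree, `Θ₀ = cfgReflect`).

No definitions, no facts; Mathlib + landed tree lemmas only. Refs (context only): K. Osterwalder, E. Seiler,
Ann. Phys. 110 (1978) 440, §2; J. Glimm, A. Jaffe, *Quantum Physics* (1987), §6.1, §9.5. [folklore]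
-/

noncomputable section

namespace Summit.QuantumFields.YangMills.Theorems.ContinuumLegGivenGap

open scoped SchwartzMap ComplexConjugate
open Filter Topology MeasureTheory
open Literature.MathematicalPhysics.QuantumFieldTheory Literature.MathematicalPhysics.QuantumLattice
  Literature.MathematicalPhysics.AQFT Literature.Probability.LatticeModels

/-! ### (1) Far box tails of the Schwartz lattice weights -/

/-- Every finite set of `p`-tuples of sites of `ℤ⁴` lies in a power `(box 4 S)ᵖ` of a centred box. [folklore] -/
theorem csclLattice_subset_piFinset_box (p : ℕ) (u : Finset (Fin p → Site 4)) :
    ∃ S : ℕ, u ⊆ Fintype.piFinset fun _ : Fin p => box 4 S := by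
  refine ⟨u.sup fun x => Finset.univ.sup fun q : Fin p × Fin 4 => (x q.1 q.2).natAbs, fun x hx => ?_⟩
  rw [Fintype.mem_piFinset]
  intro i
  rw [mem_box]
  intro μ
  have h1 : (x i μ).natAbs ≤ Finset.univ.sup fun q : Fin p × Fin 4 => (x q.1 q.2).natAbs :=
    Finset.le_sup (f := fun q : Fin p × Fin 4 => (x q.1 q.2).natAbs) (Finset.mem_univ (i, μ))
  have h2 : (Finset.univ.sup fun q : Fin p × Fin 4 => (x q.1 q.2).natAbs) ≤
      u.sup fun x : Fin p → Site 4 => Finset.univ.sup fun q : Fin p × Fin 4 => (x q.1 q.2).natAbs :=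
    Finset.le_sup (f := fun x : Fin p → Site 4 => Finset.univ.sup fun q : Fin p × Fin 4 => (x q.1 q.2).natAbs) hx
  omega

/-- **Summability of the Schwartz lattice weights**: `x ↦ (1 + ‖a x⃗‖)^{-8p}` is summable over `(ℤ⁴)ᵖ` for `0 < a`
(partial sums over `(box 4 S)ᵖ` are `≤ a^{-4p} (2(a+1))^{4p}` uniformly in `S`). [folklore] -/
theorem csclLattice_summable {a : ℝ} (ha : 0 < a) (p : ℕ) :
    Summable fun x : Fin p → Site 4 => ((1 + ‖fun i => a • siteToE (x i)‖) ^ (8 * p))⁻¹ := by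
  have hap : 0 < a ^ (4 * p) := pow_pos ha _
  refine summable_of_sum_le (c := (a ^ (4 * p))⁻¹ * (2 * (a + 1)) ^ (4 * p)) (fun x => by positivity)
    fun u => ?_
  obtain ⟨S, hS⟩ := csclLattice_subset_piFinset_box p u
  calc ∑ x ∈ u, ((1 + ‖fun i => a • siteToE (x i)‖) ^ (8 * p))⁻¹
      ≤ ∑ x ∈ Fintype.piFinset (fun _ : Fin p => box 4 S), ((1 + ‖fun i => a • siteToE (x i)‖) ^ (8 * p))⁻¹ :=
        Finset.sum_le_sum_of_subset_of_nonneg hS fun x _ _ => by positivity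
    _ = (a ^ (4 * p))⁻¹ * ∑ x ∈ Fintype.piFinset (fun _ : Fin p => box 4 S),
          a ^ (4 * p) / (1 + ‖fun i => a • siteToE (x i)‖) ^ (2 * (4 * p)) := by
        rw [Finset.mul_sum]
        refine Finset.sum_congr rfl fun x _ => ?_
        rw [show 2 * (4 * p) = 8 * p by ring, div_eq_mul_inv, ← mul_assoc, inv_mul_cancel₀ hap.ne', one_mul]
    _ ≤ (a ^ (4 * p))⁻¹ * (2 * (a + 1)) ^ (4 * p) :=
        mul_le_mul_of_nonneg_left (sum_piFinset_box_japaneseBracket_le a ha.le 4 p S) (inv_nonneg.2 hap.le)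

/-- **(1) Far box tails of the Schwartz lattice weights.** For `0 < a`, `ε > 0` there is `R` with
`∑_{x ∈ T} (1 + ‖a x⃗‖)^{-8p} ≤ ε` for every finite set `T` of `p`-tuples each of which has a site outside `box 4 R`
(Cauchy criterion for the summable family, the exceptional finite set being put inside `(box 4 R)ᵖ`). [folklore] -/
theorem csclLattice_tail (a : ℝ) (p : ℕ) (ha : 0 < a) (ε : ℝ) (hε : 0 < ε) :
    ∃ R : ℕ, ∀ T : Finset (Fin p → Site 4), (∀ x ∈ T, ∃ i, x i ∉ box 4 R) →
      ∑ x ∈ T, ((1 + ‖fun i => a • siteToE (x i)‖) ^ (8 * p))⁻¹ ≤ ε := by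
  obtain ⟨s, hs⟩ := summable_iff_vanishing.1 (csclLattice_summable ha p) (Set.Iio ε) (Iio_mem_nhds hε)
  obtain ⟨R, hR⟩ := csclLattice_subset_piFinset_box p s
  refine ⟨R, fun T hT => le_of_lt (Set.mem_Iio.1 (hs T (Finset.disjoint_left.2 fun x hxT hxs => ?_)))⟩
  obtain ⟨i, hi⟩ := hT x hxT
  exact hi (Fintype.mem_piFinset.1 (hR hxs) i)

/-! ### (2) The lattice representative: measurable, bounded, gauge invariant, cylinder -/

section Rep

variable {G : Type} [Group G] [MeasurableSpace G]

/-- Measurability of `V ↦ ∑ₓ w(x) ∏ᵢ (P(τ_{xᵢ}V) − mc)` (finite sums and products of measurable functions;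
`τ_v = configShift` is a measurable equivalence). [folklore] -/
theorem csclLattice_rep_measurable (P : YMSpecies G) {n L : ℕ} (w : (Fin n → ↥(box 4 L)) → ℂ) (mc : ℝ) :
    Measurable fun V : LGConfig 4 G => ∑ x : Fin n → ↥(box 4 L),
      w x * ∏ i, ((P.F (configShift (-(↑(x i) : Site 4)) V) - mc : ℝ) : ℂ) := by
  refine Finset.measurable_sum _ fun x _ => (Finset.measurable_prod _ fun i _ => ?_).const_mul _
  exact Complex.measurable_ofReal.comp
    ((P.measurable.comp (Literature.MathematicalPhysics.QuantumLattice.configShift _).measurable).sub_const _)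

/-- Sup bound of `V ↦ ∑ₓ w(x) ∏ᵢ (P(τ_{xᵢ}V) − mc)`: `≤ ∑ₓ ‖w x‖ (C_P + |mc|)ⁿ`. [folklore] -/
theorem csclLattice_rep_bounded (P : YMSpecies G) {n L : ℕ} (w : (Fin n → ↥(box 4 L)) → ℂ) (mc : ℝ) :
    ∃ C : ℝ, ∀ V : LGConfig 4 G, ‖∑ x : Fin n → ↥(box 4 L),
      w x * ∏ i, ((P.F (configShift (-(↑(x i) : Site 4)) V) - mc : ℝ) : ℂ)‖ ≤ C := by
  obtain ⟨CP, hCP⟩ := P.bounded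
  refine ⟨∑ x : Fin n → ↥(box 4 L), ‖w x‖ * (CP + |mc|) ^ n, fun V => ?_⟩
  refine (norm_sum_le _ _).trans (Finset.sum_le_sum fun x _ => ?_)
  rw [norm_mul, norm_prod]
  refine mul_le_mul_of_nonneg_left ?_ (norm_nonneg _)
  calc ∏ i, ‖((P.F (configShift (-(↑(x i) : Site 4)) V) - mc : ℝ) : ℂ)‖ ≤ ∏ _i : Fin n, (CP + |mc|) :=
        Finset.prod_le_prod (fun i _ => norm_nonneg _) fun i _ => by
          rw [Complex.norm_real, Real.norm_eq_abs]
          exact (abs_sub _ _).trans (add_le_add (hCP _) le_rfl)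
    _ = (CP + |mc|) ^ n := by simp

/-- Gauge invariance of `V ↦ ∑ₓ w(x) ∏ᵢ (P(τ_{xᵢ}V) − mc)` (`τ_v (U^g) = (τ_v U)^{g(· − v)}` and gauge invariance
of the species `P`). [folklore] -/
theorem csclLattice_rep_gaugeInvariant (P : YMSpecies G) {n L : ℕ} (w : (Fin n → ↥(box 4 L)) → ℂ) (mc : ℝ) :
    IsZdGaugeInvariant fun V : LGConfig 4 G => ∑ x : Fin n → ↥(box 4 L),
      w x * ∏ i, ((P.F (configShift (-(↑(x i) : Site 4)) V) - mc : ℝ) : ℂ) := by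
  intro g U
  refine Finset.sum_congr rfl fun x _ => ?_
  congr 1
  refine Finset.prod_congr rfl fun i _ => ?_
  rw [obsGeometry_configShift_gaugeTransformZd, P.gaugeInvariant]

/-- **Cylinder property**: if `Λ` contains the translated support `P.supp + xᵢ` of every tuple `x` of non-zero
weight, then `V ↦ ∑ₓ w(x) ∏ᵢ (P(τ_{xᵢ}V) − mc)` depends only on the links in `Λ`. [folklore] -/
theorem csclLattice_rep_isCylinder (P : YMSpecies G) {n L : ℕ} (w : (Fin n → ↥(box 4 L)) → ℂ) (mc : ℝ)
    {Λ : Finset (Literature.MathematicalPhysics.QuantumLattice.ZdEdge 4)}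
    (hΛ : ∀ x, w x ≠ 0 → ∀ i, ∀ e ∈ P.supp, (e.1 + (↑(x i) : Site 4), e.2) ∈ Λ) :
    IsCylinder (fun V : LGConfig 4 G => ∑ x : Fin n → ↥(box 4 L),
      w x * ∏ i, ((P.F (configShift (-(↑(x i) : Site 4)) V) - mc : ℝ) : ℂ)) Λ := by
  intro U V hUV
  refine Finset.sum_congr rfl fun x _ => ?_
  by_cases hw : w x = 0
  · simp [hw]
  congr 1
  refine Finset.prod_congr rfl fun i _ => ?_
  have h : P.F (configShift (-(↑(x i) : Site 4)) U) = P.F (configShift (-(↑(x i) : Site 4)) V) := by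
    refine P.isCylinder fun e he => ?_
    have he' : e.1 - -(↑(x i) : Site 4) = e.1 + ↑(x i) := sub_neg_eq_add _ _
    rw [Literature.MathematicalPhysics.QuantumLattice.configShift_apply,
      Literature.MathematicalPhysics.QuantumLattice.configShift_apply, he']
    exact hUV _ (Finset.mem_coe.2 (hΛ x hw i e (Finset.mem_coe.1 he)))
  rw [h]

/-- **Packaging**: under the cylinder hypothesis, `Re` and `Im` of `V ↦ ∑ₓ w(x) ∏ᵢ (P(τ_{xᵢ}V) − mc)` are local
gauge-invariant observables (`YMSpecies`) with support `Λ`. [folklore] -/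
theorem csclLattice_rep_species (P : YMSpecies G) {n L : ℕ} (w : (Fin n → ↥(box 4 L)) → ℂ) (mc : ℝ)
    {Λ : Finset (Literature.MathematicalPhysics.QuantumLattice.ZdEdge 4)}
    (hΛ : ∀ x, w x ≠ 0 → ∀ i, ∀ e ∈ P.supp, (e.1 + (↑(x i) : Site 4), e.2) ∈ Λ) :
    ∃ A₃ A₄ : YMSpecies G,
      (∀ V, A₃.F V = (∑ x : Fin n → ↥(box 4 L),
        w x * ∏ i, ((P.F (configShift (-(↑(x i) : Site 4)) V) - mc : ℝ) : ℂ)).re) ∧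
      (∀ V, A₄.F V = (∑ x : Fin n → ↥(box 4 L),
        w x * ∏ i, ((P.F (configShift (-(↑(x i) : Site 4)) V) - mc : ℝ) : ℂ)).im) := by
  obtain ⟨C, hC⟩ := csclLattice_rep_bounded P w mc
  have hcyl := csclLattice_rep_isCylinder P w mc hΛ
  have hgi := csclLattice_rep_gaugeInvariant P w mc
  have hms := csclLattice_rep_measurable P w mc
  refine ⟨⟨fun V => (∑ x : Fin n → ↥(box 4 L),
      w x * ∏ i, ((P.F (configShift (-(↑(x i) : Site 4)) V) - mc : ℝ) : ℂ)).re, Λ, ?_, ?_, ?_, ?_⟩,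
    ⟨fun V => (∑ x : Fin n → ↥(box 4 L),
      w x * ∏ i, ((P.F (configShift (-(↑(x i) : Site 4)) V) - mc : ℝ) : ℂ)).im, Λ, ?_, ?_, ?_, ?_⟩,
    fun V => rfl, fun V => rfl⟩
  · exact fun U V h => congrArg Complex.re (hcyl h)
  · exact fun g U => congrArg Complex.re (hgi g U)
  · exact ⟨C, fun V => (Complex.abs_re_le_norm _).trans (hC V)⟩
  · exact Complex.measurable_re.comp hms
  · exact fun U V h => congrArg Complex.im (hcyl h)
  · exact fun g U => congrArg Complex.im (hgi g U)
  · exact ⟨C, fun V => (Complex.abs_im_le_norm _).trans (hC V)⟩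
  · exact Complex.measurable_im.comp hms

end Rep

/-! ### (2) The time window of a test function supported in a slab -/

/-- Tuples carrying the lattice sum of a test function supported in the time slab `{a ≤ xᵢ⁰ ≤ T}` have lattice
times in `[1, ⌈T/a⌉₊]`. [folklore] -/
theorem csclLattice_time_of_ne_zero {n : ℕ} {a T : ℝ} (ha : 0 < a)
    (F : SchwartzMap (Fin n → EuclideanSpace ℝ (Fin 4)) ℂ)
    (hF : tsupport (F : (Fin n → EuclideanSpace ℝ (Fin 4)) → ℂ) ⊆ {x | ∀ i, a ≤ x i 0 ∧ x i 0 ≤ T})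
    {x : Fin n → Site 4} (hx : F (fun i => a • siteToE (x i)) ≠ 0) (i : Fin n) :
    1 ≤ x i 0 ∧ x i 0 ≤ (⌈T / a⌉₊ : ℤ) := by
  have hmem := hF (subset_tsupport _ (Function.mem_support.2 hx))
  simp only [Set.mem_setOf_eq] at hmem
  obtain ⟨h1, h2⟩ := hmem i
  simp only [PiLp.smul_apply, siteToE_apply, smul_eq_mul] at h1 h2
  refine ⟨?_, ?_⟩
  · have h3 : (1 : ℝ) ≤ (x i 0 : ℝ) := by
      by_contra h
      have h4 : a * (x i 0 : ℝ) < a * 1 := mul_lt_mul_of_pos_left (not_le.1 h) ha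
      linarith
    exact_mod_cast h3
  · have h3 : ((x i 0 : ℤ) : ℝ) ≤ T / a := by
      rw [le_div_iff₀ ha, mul_comm]
      exact h2
    have h4 : ((x i 0 : ℤ) : ℝ) ≤ ((⌈T / a⌉₊ : ℤ) : ℝ) := by
      have h5 := h3.trans (Nat.le_ceil (T / a))
      exact_mod_cast h5
    exact_mod_cast h4

section Window

variable {G : Type} [Group G] [TopologicalSpace G] [IsTopologicalGroup G] [CompactSpace G]
  [MeasurableSpace G] [BorelSpace G]

/-- **The window edge set** (union over the tuples of `(box 4 L)ⁿ` with all times in `[1, ⌈T/a⌉₊]` of the translated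
curvature supports) contains the translated curvature supports of every tuple carrying the lattice sum of a test
function supported in the slab `{a ≤ xᵢ⁰ ≤ T}`. [folklore] -/
theorem csclLattice_window_mem (r : LatticeRep G) {n : ℕ} (L : ℕ) {a T : ℝ} (ha : 0 < a)
    (F : SchwartzMap (Fin n → EuclideanSpace ℝ (Fin 4)) ℂ)
    (hF : tsupport (F : (Fin n → EuclideanSpace ℝ (Fin 4)) → ℂ) ⊆ {x | ∀ i, a ≤ x i 0 ∧ x i 0 ≤ T}) :
    ∀ x : Fin n → ↥(box 4 L), F (fun i => a • siteToE (↑(x i) : Site 4)) ≠ 0 →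
      ∀ i, ∀ e ∈ r.curvature.supp, (e.1 + (↑(x i) : Site 4), e.2) ∈
        (Finset.univ.filter fun x : Fin n → ↥(box 4 L) =>
            ∀ i, 1 ≤ (↑(x i) : Site 4) 0 ∧ (↑(x i) : Site 4) 0 ≤ (⌈T / a⌉₊ : ℤ)).biUnion
          fun x => Finset.univ.biUnion fun i : Fin n =>
            r.curvature.supp.image fun e => (e.1 + (↑(x i) : Site 4), e.2) := by
  intro x hx i e he
  have hwin : ∀ j, 1 ≤ (↑(x j) : Site 4) 0 ∧ (↑(x j) : Site 4) 0 ≤ (⌈T / a⌉₊ : ℤ) := fun j =>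
    csclLattice_time_of_ne_zero ha F hF (x := fun j => (↑(x j) : Site 4)) hx j
  refine Finset.mem_biUnion.2 ⟨x, Finset.mem_filter.2 ⟨Finset.mem_univ _, hwin⟩, ?_⟩
  refine Finset.mem_biUnion.2 ⟨i, Finset.mem_univ _, ?_⟩
  exact Finset.mem_image.2 ⟨e, he, rfl⟩

/-- Edges of the window edge set have times in `[1, ⌈T/a⌉₊ + 1]` (curvature support coordinates are `0` or `1`).
[folklore] -/
theorem csclLattice_window_time (r : LatticeRep G) (n L : ℕ) (a T : ℝ) :
    ∀ e ∈ (Finset.univ.filter fun x : Fin n → ↥(box 4 L) =>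
            ∀ i, 1 ≤ (↑(x i) : Site 4) 0 ∧ (↑(x i) : Site 4) 0 ≤ (⌈T / a⌉₊ : ℤ)).biUnion
          fun x => Finset.univ.biUnion fun i : Fin n =>
            r.curvature.supp.image fun e => (e.1 + (↑(x i) : Site 4), e.2),
      1 ≤ e.1 0 ∧ e.1 0 ≤ ((⌈T / a⌉₊ + 1 : ℕ) : ℤ) := by
  intro e he
  obtain ⟨x, hx, he1⟩ := Finset.mem_biUnion.1 he
  obtain ⟨i, -, he2⟩ := Finset.mem_biUnion.1 he1
  obtain ⟨e', he', rfl⟩ := Finset.mem_image.1 he2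
  have hxi := (Finset.mem_filter.1 hx).2 i
  have h01 := fst_mem_Icc_of_mem_curvature_supp r he' 0
  show 1 ≤ e'.1 0 + (↑(x i) : Site 4) 0 ∧ e'.1 0 + (↑(x i) : Site 4) 0 ≤ ((⌈T / a⌉₊ + 1 : ℕ) : ℤ)
  push_cast
  omega

end Window

/-- `stub_csclLattice` — **Schwartz lattice-weight tails and YMSpecies packaging of lattice representatives**
(reshape 18 glue, elementary). (1) For `0 < a`, `ε > 0` there is a box radius `R` beyond which every finite family of
`p`-tuples carries total Schwartz weight `∑ (1 + ‖a x⃗‖)^{-8p} ≤ ε` (summability over `(ℤ⁴)ᵖ` from the mesh-uniform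
Riemann bound, Cauchy criterion). (2) The lattice representative
`𝔛(V) = ∑_{x ∈ (box 4 L)ⁿ} F(a x⃗) ∏ᵢ (P(τ_{xᵢ}V) − mc)` of a test function with `tsupport F ⊆ {a ≤ xᵢ⁰ ≤ T}` is
measurable, bounded, a cylinder on an edge set with times in `[1, ⌈T/a⌉₊ + 1]`, and `Re`/`Im` of `𝔛` and of
`𝔛 ∘ Θ₀` (`Θ₀ = cfgReflect`) are local gauge-invariant observables (`YMSpecies`). [folklore] -/
theorem stub_csclLattice :
    (∀ (a : ℝ) (p : ℕ), 0 < a → ∀ ε : ℝ, 0 < ε → ∃ R : ℕ, ∀ T : Finset (Fin p → Site 4),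
      (∀ x ∈ T, ∃ i, x i ∉ box 4 R) →
        ∑ x ∈ T, ((1 + ‖fun i => a • siteToE (x i)‖) ^ (8 * p))⁻¹ ≤ ε) ∧
    (∀ (G : Type) [Group G] [TopologicalSpace G] [IsTopologicalGroup G] [CompactSpace G]
      [MeasurableSpace G] [BorelSpace G] (r : LatticeRep G) (n L : ℕ) (a mc T : ℝ)
      (F : SchwartzMap (Fin n → EuclideanSpace ℝ (Fin 4)) ℂ), 0 < a →
      tsupport (F : (Fin n → EuclideanSpace ℝ (Fin 4)) → ℂ) ⊆ {x | ∀ i, a ≤ x i 0 ∧ x i 0 ≤ T} →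
      Measurable (fun V : LGConfig 4 G => ∑ x : Fin n → ↥(box 4 L), F (fun i => a • siteToE (↑(x i) : Site 4)) * ∏ i, ((r.curvature.F (configShift (-(↑(x i) : Site 4)) V) - mc : ℝ) : ℂ)) ∧
      (∃ C : ℝ, ∀ V, ‖(fun V : LGConfig 4 G => ∑ x : Fin n → ↥(box 4 L), F (fun i => a • siteToE (↑(x i) : Site 4)) * ∏ i, ((r.curvature.F (configShift (-(↑(x i) : Site 4)) V) - mc : ℝ) : ℂ)) V‖ ≤ C) ∧
      (∃ Λ : Finset (Literature.MathematicalPhysics.QuantumLattice.ZdEdge 4), IsCylinder (fun V : LGConfig 4 G => ∑ x : Fin n → ↥(box 4 L), F (fun i => a • siteToE (↑(x i) : Site 4)) * ∏ i, ((r.curvature.F (configShift (-(↑(x i) : Site 4)) V) - mc : ℝ) : ℂ)) Λ ∧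
        ∀ e ∈ Λ, 1 ≤ e.1 0 ∧ e.1 0 ≤ ((⌈T / a⌉₊ + 1 : ℕ) : ℤ)) ∧
      ∃ A₁ A₂ A₃ A₄ : YMSpecies G,
        (∀ V, A₁.F V = ((fun V : LGConfig 4 G => ∑ x : Fin n → ↥(box 4 L), F (fun i => a • siteToE (↑(x i) : Site 4)) * ∏ i, ((r.curvature.F (configShift (-(↑(x i) : Site 4)) V) - mc : ℝ) : ℂ)) (cfgReflect V)).re) ∧ (∀ V, A₂.F V = ((fun V : LGConfig 4 G => ∑ x : Fin n → ↥(box 4 L), F (fun i => a • siteToE (↑(x i) : Site 4)) * ∏ i, ((r.curvature.F (configShift (-(↑(x i) : Site 4)) V) - mc : ℝ) : ℂ)) (cfgReflect V)).im) ∧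
        (∀ V, A₃.F V = ((fun V : LGConfig 4 G => ∑ x : Fin n → ↥(box 4 L), F (fun i => a • siteToE (↑(x i) : Site 4)) * ∏ i, ((r.curvature.F (configShift (-(↑(x i) : Site 4)) V) - mc : ℝ) : ℂ)) V).re) ∧ (∀ V, A₄.F V = ((fun V : LGConfig 4 G => ∑ x : Fin n → ↥(box 4 L), F (fun i => a • siteToE (↑(x i) : Site 4)) * ∏ i, ((r.curvature.F (configShift (-(↑(x i) : Site 4)) V) - mc : ℝ) : ℂ)) V).im)) := by
  refine ⟨fun a p ha ε hε => csclLattice_tail a p ha ε hε, ?_⟩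
  intro G _ _ _ _ _ _ r n L a mc T F ha hF
  have hΛ := csclLattice_window_mem r L ha F hF
  obtain ⟨A₃, A₄, h3, h4⟩ := csclLattice_rep_species r.curvature
    (fun x : Fin n → ↥(box 4 L) => F (fun i => a • siteToE (↑(x i) : Site 4))) mc hΛ
  exact ⟨csclLattice_rep_measurable r.curvature
      (fun x : Fin n → ↥(box 4 L) => F (fun i => a • siteToE (↑(x i) : Site 4))) mc,
    csclLattice_rep_bounded r.curvature
      (fun x : Fin n → ↥(box 4 L) => F (fun i => a • siteToE (↑(x i) : Site 4))) mc,
    ⟨_, csclLattice_rep_isCylinder r.curvature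
      (fun x : Fin n → ↥(box 4 L) => F (fun i => a • siteToE (↑(x i) : Site 4))) mc hΛ,
      csclLattice_window_time r n L a T⟩,
    A₃.timeReflect, A₄.timeReflect, A₃, A₄, fun V => h3 (cfgReflect V), fun V => h4 (cfgReflect V), h3, h4⟩

end Summit.QuantumFields.YangMills.Theorems.ContinuumLegGivenGap

end
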